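import Summits.ABC.IUTFork.LDHGenuinePerImagePrintIsm
import Summits.ABC.IUTFork.Conditional.AbcOfSCor312PerImageOfInhabited
import Summits.ABC.IUTFork.LDHGenuinePerImageFreyRowsN
import Summits.ABC.IUTFork.LDHGenuinePerImageFreyRowsB
import Summits.ABC.IUTFork.LDHGenuinePerImageAllLevelsC
import Summits.ABC.IUTFork.LDHGenuinePerImageUniform
import Mathlib.Analysis.Complex.ExponentialBounds
import HarnessLib

/-!
# The fork at [IUTchIII] Corollary 3.12, L-DH level: at the TABULATED INHABITED RATIONAL data of the cell's §S/§T.3 rows — the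
# Szpiro-bad `283 + 5¹¹13² = 2⁸3⁸17³` (every tabulated level `13 ≤ l ≤ 397`) and Reyssat `2 + 3¹⁰109 = 23⁵` (`l = 13`) — the per-image
# inequality with Θ-side over PRINT's (Ind2) FAILS for every datum, WHILE the container reading (P) holds there (abc-iut-C-cert-2 / C-cert-3)
# (abc-iut cell, crux ThetaPartII = stmt-ABC-19678; row «C:PERIMAGE-PRINT-ISM», part 4: the RATIONAL witnesses)

Record-only PROOF file (D-0012; no definition, no `Prop` fact) of the abc-iut cell (WAVE-3 discharge seat abc-iut-c312-d1, gen 11; sequel of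
`LDHGenuinePrintIsmPacket` (p509534), `LDHGenuinePerImagePrintIsm` (p510764), `LDHGenuinePerImagePrintIsmBroberg` (p511550)). TAKES NO SIDE on
[IUTchIII] Cor. 3.12.

`LDHGenuinePerImagePrintIsm` proved (`Cor22.ThetaVolumeDatumAt.not_perImage_printInd2_of_le`): at a `λ`-line point `P ∈ U` and a prime `l ≥ 5`
with `log q^{∤{2,l}}(λ) ≥ 24`, for EVERY genuine datum `T` and EVERY family `H` of packet automorphisms DOMINATED BY PRINT's (Ind2) (factorwise
abc-iut-c312-1 `Real.ismIsm (analyticLogv K) v̲_b` = `ℤ_p^×·id`, abc-iut-w5-d216 p452975), `¬ (−|log(q)| ≤ [Θ-side over H] + ((l+5)/4)·log π)`.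
THIS FILE instantiates it at the RATIONAL carriers of the C LEAD's census where the datum type is INHABITED by theorem (abc-iut-w6-d102's (P6)
list engine + abc-iut-C-cert-3's junctions `Frey283.nonempty_and_cor312Of_and_cor312PerImageOf_tabulated`, `Reyssat.nonempty_and_cor312PerImageOf_thirteen`):

* `Frey283.twentyfour_le_logQAvoid_pair` — `λ = 283/(2⁸3⁸17³)`: `log q^{∤{2,l}}(λ) ≥ 24` for EVERY prime `l ≥ 5` (this lineage's exact values
  `logQAvoid_freyE_of_notMem / _thirteen / _seventeen / _twoeightythree`, `Frey283.logQAvoid_five`; all ≥ `16·log 3 + …` with `log 3 > 1`);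
  **`Frey283.not_perImage_printInd2`** — for every prime `l ≥ 5`, every `T`, every print-dominated `H`: the inequality FAILS;
  **`Frey283.nonempty_and_not_perImage_printInd2_tabulated`** — at EVERY one of the 73 tabulated levels `13 ≤ l ≤ 397` the datum type is
  INHABITED ∧ the inequality fails for every datum and every print-dominated `H` — side by side with abc-iut-C-cert-3's
  `Frey283.nonempty_and_cor312Of_and_cor312PerImageOf_tabulated` (SAME type, SAME data: the CONTAINER readings (U) and (P) HOLD there);
  **`Frey283.exists_container_holds_and_printInd2_fails_thirteen`** — THE FORK EXHIBIT: `∃ T` at (283-triple, 13) with `T.Cor312Of ∧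
  T.Cor312PerImageOf` (container) ∧ failure of the per-image inequality over print's `Ism` for every print-dominated `H`;
* `Reyssat.twentyfour_le_logQAvoid_pair`, **`Reyssat.not_perImage_printInd2`** (`l ∉ {23, 109}`), **`Reyssat.nonempty_and_not_perImage_printInd2_thirteen`**
  — the same at `λ = 2/23⁵`, `l = 13` (inhabited; container-(P) holds, C-cert-3 `Reyssat.nonempty_and_cor312PerImageOf_thirteen`).

READING (numbers about OUR typed objects; the C LEAD's words decide the booking): at these inhabited rational (triple, l) rows the cell's TYPED
per-image Corollary (container (Ind2)) HOLDS and the SAME inequality with the Θ-side computed over PRINT's factorwise `Ism` (as typed by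
c312-1) FAILS — in kernel, at the same data, for every datum: the (Ind2)-gain of record lives entirely in `GL_{ℤ_p}(I_v) ∖ ℤ_p^×` (lattice
shears / non-isometries: Dupuy–Hilado's `Aut_{ℚ_p}(K_v : I_v)`, or print's (Ind1) strip movers of abc-iut-c312-1's R-rows). Which is print's
EFFECTIVE (Ind2) at `v ∈ 𝕍^bad` is referee finding F-B28-1's reading matter; (Ind1), (Ind3), the log-link, Cor. 3.12 itself are untouched;
refuted-as-typed ≠ refuted in print; no height bound follows (known triples); nothing here asserts that abc is proved or refuted; no side taken.
[cite: Mochizuki2012, IUTchIII Cor. 3.12 p. 173–174; Thm. 3.11 (i) p. 154] [cite: Mochizuki2012, IUTchIV Thm. 1.10 p. 23; Cor. 2.2 (ii) proof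
(P5)(P6)(P7) p. 46] [cite: Mochizuki2012, IUTchII Ex. 1.8 (iv) p. 39] [cite: DupuyHilado2025, §4.9, §4.12] [claim: Mochizuki2012, status: disputed]
for every IUT quotation. Axioms: standard three.
-/

noncomputable section

open NumberField IsDedekindDomain

namespace Literature.IUT.LogVolume.Cor22

open Summit.ABC.IUTFork Summit.ABC.IUTFork.Thm311.Real Literature.NumberTheory.NumberFields
open Literature.NumberTheory.DiophantineGeometry Literature.NumberTheory.DiophantineGeometry.GenEll

/-- `1 < log 3 ≤ log 5 ≤ log 13 ≤ log 17 ≤ log 23 ≤ log 109 ≤ log 283` — the crude bounds used below (`e < 2.72 < 3`). [folklore] -/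
private theorem log_bounds :
    (1 : ℝ) < Real.log 3 ∧ Real.log 3 ≤ Real.log 5 ∧ Real.log 3 ≤ Real.log 13 ∧ Real.log 3 ≤ Real.log 17 ∧
      Real.log 3 ≤ Real.log 23 ∧ Real.log 3 ≤ Real.log 109 ∧ Real.log 3 ≤ Real.log 283 := by
  refine ⟨?_, Real.log_le_log (by norm_num) (by norm_num), Real.log_le_log (by norm_num) (by norm_num),
    Real.log_le_log (by norm_num) (by norm_num), Real.log_le_log (by norm_num) (by norm_num),
    Real.log_le_log (by norm_num) (by norm_num), Real.log_le_log (by norm_num) (by norm_num)⟩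
  rw [Real.lt_log_iff_exp_lt (by norm_num)]
  have := Real.exp_one_lt_d9
  linarith

/-! ## 1. `283 + 5¹¹·13² = 2⁸·3⁸·17³` (`λ = 283/8251953408`) -/

namespace Frey283

/-- **`24 ≤ log q^{∤{2,l}}(λ)` for EVERY prime `l ≥ 5`** at `λ = 283/(2⁸3⁸17³)` (exact values of this lineage / abc-iut-C-cert-2 by name: off
`{2,3,5,13,17,283}` it is `16·log 3 + 22·log 5 + 4·log 13 + 6·log 17 + 2·log 283`; at `l = 5, 13, 17, 283` the corresponding summand drops).
[cite: Mochizuki2012, IUTchIV Thm. 1.10 p. 23] [claim: Mochizuki2012, status: disputed] -/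
theorem twentyfour_le_logQAvoid_pair {l : ℕ} (hl : l.Prime) (h5 : 5 ≤ l) :
    24 ≤ logQAvoid (ratPoint ((283 : ℚ) / 8251953408)) {2, l} := by
  obtain ⟨h3, h5', h13, h17, -, -, h283⟩ := log_bounds
  by_cases hlI : l ∈ ({2, 3, 5, 13, 17, 283} : Finset ℕ)
  · have hlI' := hlI
    simp only [Finset.mem_insert, Finset.mem_singleton] at hlI'
    rcases hlI' with rfl | rfl | rfl | rfl | rfl | rfl
    · omega
    · omega
    · rw [Frey283.logQAvoid_five]; linarith
    · rw [logQAvoid_freyE_thirteen]; linarith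
    · rw [logQAvoid_freyE_seventeen]; linarith
    · rw [logQAvoid_freyE_twoeightythree]; linarith
  · rw [logQAvoid_freyE_of_notMem hl hlI]; linarith

/-- The same in the carrier spelling of the (P6) list engine / abc-iut-C-cert-3's junctions (`((283 : ℕ) : ℚ) / (8251953408 : ℕ)`).
[cite: Mochizuki2012, IUTchIV Thm. 1.10 p. 23] [claim: Mochizuki2012, status: disputed] -/
theorem twentyfour_le_logQAvoid_pair' {l : ℕ} (hl : l.Prime) (h5 : 5 ≤ l) :
    24 ≤ logQAvoid (ratPoint (((283 : ℕ) : ℚ) / (8251953408 : ℕ))) {2, l} := by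
  have hq : (((283 : ℕ) : ℚ) / (8251953408 : ℕ)) = ((283 : ℚ) / 8251953408) := by norm_num
  rw [hq]
  exact twentyfour_le_logQAvoid_pair hl h5

/-- **At `λ = 283/(2⁸3⁸17³)`, for EVERY prime `l ≥ 5`, every genuine datum `T` and every family `H` of packet automorphisms DOMINATED BY PRINT's
(Ind2)** (factorwise abc-iut-c312-1 `Real.ismIsm (analyticLogv K) v̲_b`): the per-image inequality with Θ-side computed over `H` FAILS
(`not_perImage_printInd2_of_le`; `λ ∈ U` since `λ ∉ {0, 1}`). [cite: Mochizuki2012, IUTchIII Cor. 3.12 p. 173–174; Thm. 3.11 (i) p. 154]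
[claim: Mochizuki2012, status: disputed] -/
theorem not_perImage_printInd2 {l : ℕ} (hl : l.Prime) (h5 : 5 ≤ l)
    (T : ThetaVolumeDatumAt (ratPoint (((283 : ℕ) : ℚ) / (8251953408 : ℕ))) l) :
    letI := T.instFieldF; letI := T.instNumberFieldF; letI := T.instFieldK; letI := T.instNumberFieldK
    letI := T.instAlgebraK; letI := T.instIsElliptic
    ∀ (H : (p : ℕ) → (hp : p.Prime) → (j : ℕ) →
        (e : Fin (j + 1) → placesOver (Literature.IUT.HodgeTheaters.fieldOfModuli T.E) p) →
        haveI : Fact p.Prime := ⟨hp⟩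
        Subgroup (PacketAlgebra p (fun b => (T.I.σ.localFields p).k (e b)) ≃ₗ[ℚ_[p]]
          PacketAlgebra p (fun b => (T.I.σ.localFields p).k (e b)))),
      (∀ (p : ℕ) (hp : p.Prime), haveI : Fact p.Prime := ⟨hp⟩
        ∀ j e, ∀ g ∈ H p hp j e,
          ∃ ψ : ∀ b : Fin (j + 1), Carrier (.inr (T.I.σ.lift (e b).1) : Thm311.Real.Place T.K) ≃ₗ[ℚ]
              Carrier (.inr (T.I.σ.lift (e b).1) : Thm311.Real.Place T.K),
            (∀ b, ψ b ∈ ismIsm (analyticLogv T.K) (T.I.σ.lift (e b).1)) ∧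
            ∀ x : ∀ b, (T.I.σ.localFields p).k (e b),
              (g : PacketAlgebra p (fun b => (T.I.σ.localFields p).k (e b)) ≃ₗ[ℚ_[p]]
                  PacketAlgebra p (fun b => (T.I.σ.localFields p).k (e b))) (PiTensorProduct.tprod ℚ_[p] x) =
                PiTensorProduct.tprod ℚ_[p] (fun b =>
                  RescaledCompletion.of T.K p (T.I.σ.lift (e b).1) (T.I.σ.natCast_mem_lift (e b))
                    (ψ b ((RescaledCompletion.of T.K p (T.I.σ.lift (e b).1) (T.I.σ.natCast_mem_lift (e b))).symm (x b))))) →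
      ¬ (T.negAbsLogQ ≤
          (∑ p ∈ T.I.supportPrimes,
            if hp : p.Prime then
              (haveI : Fact p.Prime := ⟨hp⟩
               (T.I.packetAt p hp).lnνLp T.I.lstar (fun j e =>
                 packetHull p (fun b => (T.I.σ.localFields p).k (e b))
                   (⋃ g : H p hp j e, (g : PacketAlgebra p (fun b => (T.I.σ.localFields p).k (e b)) ≃ₗ[ℚ_[p]]
                       PacketAlgebra p (fun b => (T.I.σ.localFields p).k (e b))) ''
                     (T.I.packetAt p hp).pilotRegion (T.I.tΘ p hp) j e)))
            else 0) + ThetaVolumeInput.archLogTheta l) :=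
  T.not_perImage_printInd2_of_le (ratPoint_mem_UPle_one (by norm_num) (by norm_num)).1.1 h5
    (twentyfour_le_logQAvoid_pair' hl h5)

/-- **AT EVERY ONE OF THE 73 TABULATED LEVELS `13 ≤ l ≤ 397` of the Szpiro-bad row `283 + 5¹¹13² = 2⁸3⁸17³`: the genuine datum type is
INHABITED (abc-iut-w6-d102 / abc-iut-C-cert-3 `Frey283.nonempty_and_cor312Of_and_cor312PerImageOf_tabulated`, by name) AND for every datum and
every print-dominated `H` the per-image inequality over PRINT's (Ind2) FAILS** — while, by the SAME junction theorem, the CONTAINER readings (U)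
and (P) hold for every datum there. [cite: Mochizuki2012, IUTchIII Cor. 3.12 p. 173–174] [cite: Mochizuki2012, IUTchIV Cor. 2.2 (ii) proof
(P6)(P7) p. 46] [claim: Mochizuki2012, status: disputed] -/
theorem nonempty_and_not_perImage_printInd2_tabulated :
    ∀ l ∈ ([13, 17, 19, 23, 29, 31, 37, 41, 43, 47, 53, 59, 61, 67, 71, 73, 79, 83, 89, 97, 101, 103, 107, 109, 113, 127, 131,
      137, 139, 149, 151, 157, 163, 167, 173, 179, 181, 191, 193, 197, 199, 211, 223, 227, 229, 233, 239, 241, 251,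
      257, 263, 269, 271, 277, 281, 283, 293, 307, 311, 313, 317, 331, 337, 347, 349, 353, 359, 367, 373, 379, 383,
      389, 397] : List ℕ),
    Nonempty (ThetaVolumeDatumAt (ratPoint (((283 : ℕ) : ℚ) / (8251953408 : ℕ))) l) ∧
    ∀ T : ThetaVolumeDatumAt (ratPoint (((283 : ℕ) : ℚ) / (8251953408 : ℕ))) l,
    letI := T.instFieldF; letI := T.instNumberFieldF; letI := T.instFieldK; letI := T.instNumberFieldK
    letI := T.instAlgebraK; letI := T.instIsElliptic
    ∀ (H : (p : ℕ) → (hp : p.Prime) → (j : ℕ) →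
        (e : Fin (j + 1) → placesOver (Literature.IUT.HodgeTheaters.fieldOfModuli T.E) p) →
        haveI : Fact p.Prime := ⟨hp⟩
        Subgroup (PacketAlgebra p (fun b => (T.I.σ.localFields p).k (e b)) ≃ₗ[ℚ_[p]]
          PacketAlgebra p (fun b => (T.I.σ.localFields p).k (e b)))),
      (∀ (p : ℕ) (hp : p.Prime), haveI : Fact p.Prime := ⟨hp⟩
        ∀ j e, ∀ g ∈ H p hp j e,
          ∃ ψ : ∀ b : Fin (j + 1), Carrier (.inr (T.I.σ.lift (e b).1) : Thm311.Real.Place T.K) ≃ₗ[ℚ]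
              Carrier (.inr (T.I.σ.lift (e b).1) : Thm311.Real.Place T.K),
            (∀ b, ψ b ∈ ismIsm (analyticLogv T.K) (T.I.σ.lift (e b).1)) ∧
            ∀ x : ∀ b, (T.I.σ.localFields p).k (e b),
              (g : PacketAlgebra p (fun b => (T.I.σ.localFields p).k (e b)) ≃ₗ[ℚ_[p]]
                  PacketAlgebra p (fun b => (T.I.σ.localFields p).k (e b))) (PiTensorProduct.tprod ℚ_[p] x) =
                PiTensorProduct.tprod ℚ_[p] (fun b =>
                  RescaledCompletion.of T.K p (T.I.σ.lift (e b).1) (T.I.σ.natCast_mem_lift (e b))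
                    (ψ b ((RescaledCompletion.of T.K p (T.I.σ.lift (e b).1) (T.I.σ.natCast_mem_lift (e b))).symm (x b))))) →
      ¬ (T.negAbsLogQ ≤
          (∑ p ∈ T.I.supportPrimes,
            if hp : p.Prime then
              (haveI : Fact p.Prime := ⟨hp⟩
               (T.I.packetAt p hp).lnνLp T.I.lstar (fun j e =>
                 packetHull p (fun b => (T.I.σ.localFields p).k (e b))
                   (⋃ g : H p hp j e, (g : PacketAlgebra p (fun b => (T.I.σ.localFields p).k (e b)) ≃ₗ[ℚ_[p]]
                       PacketAlgebra p (fun b => (T.I.σ.localFields p).k (e b))) ''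
                     (T.I.packetAt p hp).pilotRegion (T.I.tΘ p hp) j e)))
            else 0) + ThetaVolumeInput.archLogTheta l) := by
  intro l hl
  have hside : ∀ l ∈ ([13, 17, 19, 23, 29, 31, 37, 41, 43, 47, 53, 59, 61, 67, 71, 73, 79, 83, 89, 97, 101, 103, 107, 109, 113, 127, 131,
      137, 139, 149, 151, 157, 163, 167, 173, 179, 181, 191, 193, 197, 199, 211, 223, 227, 229, 233, 239, 241, 251,
      257, 263, 269, 271, 277, 281, 283, 293, 307, 311, 313, 317, 331, 337, 347, 349, 353, 359, 367, 373, 379, 383,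
      389, 397] : List ℕ), l.Prime ∧ 5 ≤ l := by decide +kernel
  exact ⟨(Conditional.Frey283.nonempty_and_cor312Of_and_cor312PerImageOf_tabulated l hl).1,
    fun T => not_perImage_printInd2 (hside l hl).1 (hside l hl).2 T⟩

/-- **THE FORK EXHIBIT at (283-triple, `l = 13`)**: there EXISTS a genuine Θ-volume datum `T` at which the cell's TYPED Corollary HOLDS in
BOTH readings (U) and (P) — Θ-side over the Dupuy–Hilado CONTAINER (abc-iut-C-cert-3 junction, by name) — AND the per-image inequality with the
Θ-side computed over PRINT's factorwise `Ism` FAILS for every print-dominated `H`: the two (Ind2) readings of record DISAGREE at one and the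
same exhibited datum. [cite: Mochizuki2012, IUTchIII Cor. 3.12 p. 173–174; Thm. 3.11 (i) p. 154] [cite: DupuyHilado2025, §4.9]
[claim: Mochizuki2012, status: disputed] -/
theorem exists_container_holds_and_printInd2_fails_thirteen :
    ∃ T : ThetaVolumeDatumAt (ratPoint (((283 : ℕ) : ℚ) / (8251953408 : ℕ))) 13,
    T.Cor312Of ∧ T.Cor312PerImageOf ∧
    letI := T.instFieldF; letI := T.instNumberFieldF; letI := T.instFieldK; letI := T.instNumberFieldK
    letI := T.instAlgebraK; letI := T.instIsElliptic
    ∀ (H : (p : ℕ) → (hp : p.Prime) → (j : ℕ) →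
        (e : Fin (j + 1) → placesOver (Literature.IUT.HodgeTheaters.fieldOfModuli T.E) p) →
        haveI : Fact p.Prime := ⟨hp⟩
        Subgroup (PacketAlgebra p (fun b => (T.I.σ.localFields p).k (e b)) ≃ₗ[ℚ_[p]]
          PacketAlgebra p (fun b => (T.I.σ.localFields p).k (e b)))),
      (∀ (p : ℕ) (hp : p.Prime), haveI : Fact p.Prime := ⟨hp⟩
        ∀ j e, ∀ g ∈ H p hp j e,
          ∃ ψ : ∀ b : Fin (j + 1), Carrier (.inr (T.I.σ.lift (e b).1) : Thm311.Real.Place T.K) ≃ₗ[ℚ]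
              Carrier (.inr (T.I.σ.lift (e b).1) : Thm311.Real.Place T.K),
            (∀ b, ψ b ∈ ismIsm (analyticLogv T.K) (T.I.σ.lift (e b).1)) ∧
            ∀ x : ∀ b, (T.I.σ.localFields p).k (e b),
              (g : PacketAlgebra p (fun b => (T.I.σ.localFields p).k (e b)) ≃ₗ[ℚ_[p]]
                  PacketAlgebra p (fun b => (T.I.σ.localFields p).k (e b))) (PiTensorProduct.tprod ℚ_[p] x) =
                PiTensorProduct.tprod ℚ_[p] (fun b =>
                  RescaledCompletion.of T.K p (T.I.σ.lift (e b).1) (T.I.σ.natCast_mem_lift (e b))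
                    (ψ b ((RescaledCompletion.of T.K p (T.I.σ.lift (e b).1) (T.I.σ.natCast_mem_lift (e b))).symm (x b))))) →
      ¬ (T.negAbsLogQ ≤
          (∑ p ∈ T.I.supportPrimes,
            if hp : p.Prime then
              (haveI : Fact p.Prime := ⟨hp⟩
               (T.I.packetAt p hp).lnνLp T.I.lstar (fun j e =>
                 packetHull p (fun b => (T.I.σ.localFields p).k (e b))
                   (⋃ g : H p hp j e, (g : PacketAlgebra p (fun b => (T.I.σ.localFields p).k (e b)) ≃ₗ[ℚ_[p]]
                       PacketAlgebra p (fun b => (T.I.σ.localFields p).k (e b))) ''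
                     (T.I.packetAt p hp).pilotRegion (T.I.tΘ p hp) j e)))
            else 0) + ThetaVolumeInput.archLogTheta 13) :=
  have h13 : Nat.Prime 13 ∧ 5 ≤ 13 := by norm_num
  (Conditional.Frey283.nonempty_and_cor312Of_and_cor312PerImageOf_tabulated 13 (List.mem_cons_self ..)).elim
    fun hne hUP => hne.elim fun T => ⟨T, (hUP T).1, (hUP T).2, not_perImage_printInd2 h13.1 h13.2 T⟩

end Frey283

/-! ## 2. Reyssat `2 + 3¹⁰·109 = 23⁵` (`λ = 2/6436343`) -/

namespace Reyssat

/-- **`24 ≤ log q^{∤{2,l}}(λ)` at `λ = 2/23⁵` for every prime `l ∉ {3, 23, 109}`**: `20·log 3 + 10·log 23 + 2·log 109 ≥ 32·log 3 > 24`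
(this lineage's `logQAvoid_reyssat_of_notMem`). [cite: Mochizuki2012, IUTchIV Thm. 1.10 p. 23] [claim: Mochizuki2012, status: disputed] -/
theorem twentyfour_le_logQAvoid_pair {l : ℕ} (hl : l.Prime) (hlI : l ∉ ({3, 23, 109} : Finset ℕ)) :
    24 ≤ logQAvoid (ratPoint ((2 : ℚ) / 6436343)) {2, l} := by
  obtain ⟨h3, -, -, -, h23, h109, -⟩ := log_bounds
  rw [logQAvoid_reyssat_of_notMem hl hlI]; linarith

/-- The same in the carrier spelling `((2 : ℕ) : ℚ) / (6436343 : ℕ)` (`23⁵ = 6436343`).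
[cite: Mochizuki2012, IUTchIV Thm. 1.10 p. 23] [claim: Mochizuki2012, status: disputed] -/
theorem twentyfour_le_logQAvoid_pair' {l : ℕ} (hl : l.Prime) (hlI : l ∉ ({3, 23, 109} : Finset ℕ)) :
    24 ≤ logQAvoid (ratPoint (((2 : ℕ) : ℚ) / (6436343 : ℕ))) {2, l} := by
  have hq : (((2 : ℕ) : ℚ) / (6436343 : ℕ)) = ((2 : ℚ) / 6436343) := by norm_num
  rw [hq]
  exact twentyfour_le_logQAvoid_pair hl hlI

/-- **At `λ = 2/23⁵`, for every prime `l ≥ 5` off `{23, 109}`, every genuine datum `T` and every print-dominated `H`: the per-image inequality over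
PRINT's (Ind2) FAILS.** [cite: Mochizuki2012, IUTchIII Cor. 3.12 p. 173–174; Thm. 3.11 (i) p. 154] [claim: Mochizuki2012, status: disputed] -/
theorem not_perImage_printInd2 {l : ℕ} (hl : l.Prime) (h5 : 5 ≤ l) (hlI : l ∉ ({3, 23, 109} : Finset ℕ))
    (T : ThetaVolumeDatumAt (ratPoint (((2 : ℕ) : ℚ) / (6436343 : ℕ))) l) :
    letI := T.instFieldF; letI := T.instNumberFieldF; letI := T.instFieldK; letI := T.instNumberFieldK
    letI := T.instAlgebraK; letI := T.instIsElliptic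
    ∀ (H : (p : ℕ) → (hp : p.Prime) → (j : ℕ) →
        (e : Fin (j + 1) → placesOver (Literature.IUT.HodgeTheaters.fieldOfModuli T.E) p) →
        haveI : Fact p.Prime := ⟨hp⟩
        Subgroup (PacketAlgebra p (fun b => (T.I.σ.localFields p).k (e b)) ≃ₗ[ℚ_[p]]
          PacketAlgebra p (fun b => (T.I.σ.localFields p).k (e b)))),
      (∀ (p : ℕ) (hp : p.Prime), haveI : Fact p.Prime := ⟨hp⟩
        ∀ j e, ∀ g ∈ H p hp j e,
          ∃ ψ : ∀ b : Fin (j + 1), Carrier (.inr (T.I.σ.lift (e b).1) : Thm311.Real.Place T.K) ≃ₗ[ℚ]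
              Carrier (.inr (T.I.σ.lift (e b).1) : Thm311.Real.Place T.K),
            (∀ b, ψ b ∈ ismIsm (analyticLogv T.K) (T.I.σ.lift (e b).1)) ∧
            ∀ x : ∀ b, (T.I.σ.localFields p).k (e b),
              (g : PacketAlgebra p (fun b => (T.I.σ.localFields p).k (e b)) ≃ₗ[ℚ_[p]]
                  PacketAlgebra p (fun b => (T.I.σ.localFields p).k (e b))) (PiTensorProduct.tprod ℚ_[p] x) =
                PiTensorProduct.tprod ℚ_[p] (fun b =>
                  RescaledCompletion.of T.K p (T.I.σ.lift (e b).1) (T.I.σ.natCast_mem_lift (e b))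
                    (ψ b ((RescaledCompletion.of T.K p (T.I.σ.lift (e b).1) (T.I.σ.natCast_mem_lift (e b))).symm (x b))))) →
      ¬ (T.negAbsLogQ ≤
          (∑ p ∈ T.I.supportPrimes,
            if hp : p.Prime then
              (haveI : Fact p.Prime := ⟨hp⟩
               (T.I.packetAt p hp).lnνLp T.I.lstar (fun j e =>
                 packetHull p (fun b => (T.I.σ.localFields p).k (e b))
                   (⋃ g : H p hp j e, (g : PacketAlgebra p (fun b => (T.I.σ.localFields p).k (e b)) ≃ₗ[ℚ_[p]]
                       PacketAlgebra p (fun b => (T.I.σ.localFields p).k (e b))) ''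
                     (T.I.packetAt p hp).pilotRegion (T.I.tΘ p hp) j e)))
            else 0) + ThetaVolumeInput.archLogTheta l) :=
  T.not_perImage_printInd2_of_le (ratPoint_mem_UPle_one (by norm_num) (by norm_num)).1.1 h5
    (twentyfour_le_logQAvoid_pair' hl hlI)

/-- **REYSSAT AT `l = 13`: the genuine datum type is INHABITED (abc-iut-C-cert-3 `Reyssat.nonempty_and_cor312PerImageOf_thirteen`, (P6) =
abc-iut-w6-d102 `FreyP6Reyssat.condP6_thirteen`) AND for every datum and every print-dominated `H` the per-image inequality over PRINT's (Ind2)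
FAILS** — while the container reading (P) holds there for every datum (same junction). [cite: Mochizuki2012, IUTchIII Cor. 3.12 p. 173–174]
[cite: Mochizuki2012, IUTchIV Cor. 2.2 (ii) proof (P6)(P7) p. 46] [claim: Mochizuki2012, status: disputed] -/
theorem nonempty_and_not_perImage_printInd2_thirteen :
    Nonempty (ThetaVolumeDatumAt (ratPoint (((2 : ℕ) : ℚ) / (6436343 : ℕ))) 13) ∧
    ∀ T : ThetaVolumeDatumAt (ratPoint (((2 : ℕ) : ℚ) / (6436343 : ℕ))) 13,
    letI := T.instFieldF; letI := T.instNumberFieldF; letI := T.instFieldK; letI := T.instNumberFieldK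
    letI := T.instAlgebraK; letI := T.instIsElliptic
    ∀ (H : (p : ℕ) → (hp : p.Prime) → (j : ℕ) →
        (e : Fin (j + 1) → placesOver (Literature.IUT.HodgeTheaters.fieldOfModuli T.E) p) →
        haveI : Fact p.Prime := ⟨hp⟩
        Subgroup (PacketAlgebra p (fun b => (T.I.σ.localFields p).k (e b)) ≃ₗ[ℚ_[p]]
          PacketAlgebra p (fun b => (T.I.σ.localFields p).k (e b)))),
      (∀ (p : ℕ) (hp : p.Prime), haveI : Fact p.Prime := ⟨hp⟩
        ∀ j e, ∀ g ∈ H p hp j e,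
          ∃ ψ : ∀ b : Fin (j + 1), Carrier (.inr (T.I.σ.lift (e b).1) : Thm311.Real.Place T.K) ≃ₗ[ℚ]
              Carrier (.inr (T.I.σ.lift (e b).1) : Thm311.Real.Place T.K),
            (∀ b, ψ b ∈ ismIsm (analyticLogv T.K) (T.I.σ.lift (e b).1)) ∧
            ∀ x : ∀ b, (T.I.σ.localFields p).k (e b),
              (g : PacketAlgebra p (fun b => (T.I.σ.localFields p).k (e b)) ≃ₗ[ℚ_[p]]
                  PacketAlgebra p (fun b => (T.I.σ.localFields p).k (e b))) (PiTensorProduct.tprod ℚ_[p] x) =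
                PiTensorProduct.tprod ℚ_[p] (fun b =>
                  RescaledCompletion.of T.K p (T.I.σ.lift (e b).1) (T.I.σ.natCast_mem_lift (e b))
                    (ψ b ((RescaledCompletion.of T.K p (T.I.σ.lift (e b).1) (T.I.σ.natCast_mem_lift (e b))).symm (x b))))) →
      ¬ (T.negAbsLogQ ≤
          (∑ p ∈ T.I.supportPrimes,
            if hp : p.Prime then
              (haveI : Fact p.Prime := ⟨hp⟩
               (T.I.packetAt p hp).lnνLp T.I.lstar (fun j e =>
                 packetHull p (fun b => (T.I.σ.localFields p).k (e b))
                   (⋃ g : H p hp j e, (g : PacketAlgebra p (fun b => (T.I.σ.localFields p).k (e b)) ≃ₗ[ℚ_[p]]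
                       PacketAlgebra p (fun b => (T.I.σ.localFields p).k (e b))) ''
                     (T.I.packetAt p hp).pilotRegion (T.I.tΘ p hp) j e)))
            else 0) + ThetaVolumeInput.archLogTheta 13) := by
  have hne := Conditional.Reyssat.nonempty_and_cor312PerImageOf_thirteen.1
  have hq : (((2 : ℕ) : ℚ) / (23 ^ 5 : ℕ)) = (((2 : ℕ) : ℚ) / (6436343 : ℕ)) := by norm_num
  rw [hq] at hne
  exact ⟨hne, fun T => not_perImage_printInd2 (by norm_num) (by norm_num) (by decide) T⟩

end Reyssat

end Literature.IUT.LogVolume.Cor22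

end
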